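import Summits.MatrixMultiplication.MatrixMultiplication.Theses.LevelGradedCohnUmans
import Summits.MatrixMultiplication.MatrixMultiplication.Theorems.GradedDesignFamily.Negative.FamilyNeumann

/-!
# The separator rank law: near-extremal graded designs have degenerate separators
# (crux `LevelGradedCohnUmans.GradedDesignFamily`, stmt-MatrixMultiplication-7610; negative side, lead c3)

Let `J ≤ ℂ^G` be BI-INVARIANT and `(X, Y, Z)` `J`-separated (route clause).  For a separator `f ∈ J` of a
target `(x₀, z₀)` let `r(f) := dim span{L_g f : g ∈ G}` (`(L_g f)(h) = f(g h)`), the dimension of the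
left-translation module generated by `f` — the rank of the "Hankel" matrix `(f(g h))_{g,h}`;
`r(f) ≤ dim J` always.

* `separator_rank_law` — `|Y|·(|X| + |Z| − 1) + r(f) ≤ 2·dim J`
  (stated as `|Y|(|X|+|Z|) + r(f) ≤ 2 dim J + |Y|`).

So a NON-DEGENERATE separator (`r(f) = dim J`) forces the "Neumann-Y" count
`|Y|(|X| + |Z| − 1) ≤ dim J` (crux strategist census F3; the route's empirical "0 violations in 30 092
separated triples"), and conversely every design near the graded Neumann wall (shape `(t, 2t, t)`,
`t² ≈ dim J/3`, so `|Y|(|X|+|Z|−1) ≈ 4 dim J/3`) has ALL separators degenerate: `r(f) ≤ (2/3 + o(1)) dim J`.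

PROOF.  (★) The `|X||Y|` translates `L_{x⁻¹y} f` span a subspace `U ≤ J`; the `|Y||Z|` evaluations
`φ ↦ φ(y'⁻¹ z)` map `J` onto `ℂ^{Y×Z}`; the matrix `(L_{x⁻¹y} f)(y'⁻¹z) = f(x⁻¹ y y'⁻¹ z)` is the
separation pattern, zero unless `x = x₀` and then the coordinate vector of `(y, z₀)`: by the rank core
(`rank_core_span`), `dim U + |Y||Z| ≤ dim J + |Y|`.  (★★) The map `Θ : J* → ℂ^G`,
`Θ(λ)(h) = λ(R_h f)`, sends the evaluation `ev_g` to `L_g f`; the evaluations at the `|X||Y|` points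
`x⁻¹ y` are linearly independent on `J` (the `XY` wall), so `r(f) = dim Θ(span ev_G) ≤ dim Θ(span ev_{X⁻¹Y}) + (dim J − |X||Y|) = dim U + dim J − |X||Y|`
(`finrank_map_add_le`).  Add.

Sorry-free; axioms `propext`, `Classical.choice`, `Quot.sound`.
-/

set_option linter.dupNamespace false

noncomputable section

open scoped BigOperators
open Module

namespace Summit.MatrixMultiplication.MatrixMultiplication.Theorems.GradedDesignFamily.Negative

/-! ## Two linear-algebra lemmas -/

/-- **Rank core, span form.**  In a finite-dimensional space `V`: vectors `f_r`, a linear map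
`Ψ : V → K^C` ONTO `K^C`, and the images `Ψ f_r` all in `{0} ∪ {φ_t : t ∈ T}` force
`dim span{f_r} + |C| ≤ dim V + |T|`. -/
theorem rank_core_span {K : Type*} [Field K] {V : Type*} [AddCommGroup V] [Module K V]
    [FiniteDimensional K V] {R C T : Type*} [Fintype C] [Fintype T]
    (f : R → V) (Ψ : V →ₗ[K] (C → K))
    (hΨ : Function.Surjective Ψ) (φ : T → (C → K))
    (hφ : ∀ r, Ψ (f r) = 0 ∨ ∃ t, Ψ (f r) = φ t) :
    finrank K (Submodule.span K (Set.range f)) + Fintype.card C ≤ finrank K V + Fintype.card T := by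
  classical
  set U : Submodule K V := Submodule.span K (Set.range f) with hUdef
  set Ψ' : U →ₗ[K] (C → K) := Ψ.domRestrict U with hΨ'def
  have hrn := LinearMap.finrank_range_add_finrank_ker Ψ'
  have hrange : LinearMap.range Ψ' ≤ Submodule.span K (Set.range φ) := by
    rintro w ⟨u, rfl⟩
    rw [hΨ'def, LinearMap.domRestrict_apply]
    have hmap : U.map Ψ ≤ Submodule.span K (Set.range φ) := by
      rw [hUdef, Submodule.map_span, Submodule.span_le]
      rintro _ ⟨_, ⟨r, rfl⟩, rfl⟩
      rcases hφ r with h0 | ⟨t, ht⟩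
      · rw [h0]; exact Submodule.zero_mem _
      · rw [ht]; exact Submodule.subset_span ⟨t, rfl⟩
    exact hmap (Submodule.mem_map_of_mem u.2)
  have h1 : finrank K (LinearMap.range Ψ') ≤ Fintype.card T :=
    (Submodule.finrank_mono hrange).trans (finrank_range_le_card φ)
  set g : LinearMap.ker Ψ' →ₗ[K] V := U.subtype.comp (LinearMap.ker Ψ').subtype with hgdef
  have hginj : Function.Injective g :=
    Subtype.val_injective.comp Subtype.val_injective
  have hgrange : LinearMap.range g ≤ LinearMap.ker Ψ := by
    rintro _ ⟨w, rfl⟩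
    have hw : Ψ' w.1 = 0 := w.2
    show Ψ ((w.1 : U) : V) = 0
    exact hw
  have h2 : finrank K (LinearMap.ker Ψ') ≤ finrank K (LinearMap.ker Ψ) := by
    rw [← LinearMap.finrank_range_of_inj hginj]
    exact Submodule.finrank_mono hgrange
  have hrnΨ := LinearMap.finrank_range_add_finrank_ker Ψ
  rw [LinearMap.range_eq_top.mpr hΨ, finrank_top, Module.finrank_fintype_fun_eq_card] at hrnΨ
  omega

/-- **Images of nested subspaces.**  For `W' ≤ W` and a linear map `Θ`:
`dim Θ(W) + dim W' ≤ dim Θ(W') + dim W` (the rank can grow by at most the codimension). -/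
theorem finrank_map_add_le {K : Type*} [Field K] {V V₂ : Type*} [AddCommGroup V] [Module K V]
    [FiniteDimensional K V] [AddCommGroup V₂] [Module K V₂] [FiniteDimensional K V₂]
    (Θ : V →ₗ[K] V₂) {W' W : Submodule K V} (hW : W' ≤ W) :
    finrank K (W.map Θ) + finrank K W' ≤ finrank K (W'.map Θ) + finrank K W := by
  -- rank–nullity for `Θ` restricted to `W` and to `W'`
  have hr := LinearMap.finrank_range_add_finrank_ker (Θ.domRestrict W)
  have hr' := LinearMap.finrank_range_add_finrank_ker (Θ.domRestrict W')
  have hrangeW : LinearMap.range (Θ.domRestrict W) = W.map Θ := by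
    rw [LinearMap.domRestrict, LinearMap.range_comp, Submodule.range_subtype]
  have hrangeW' : LinearMap.range (Θ.domRestrict W') = W'.map Θ := by
    rw [LinearMap.domRestrict, LinearMap.range_comp, Submodule.range_subtype]
  rw [hrangeW] at hr
  rw [hrangeW'] at hr'
  -- the kernel on `W'` embeds in the kernel on `W`
  let ι : LinearMap.ker (Θ.domRestrict W') →ₗ[K] LinearMap.ker (Θ.domRestrict W) :=
    { toFun := fun u => ⟨⟨(u.1 : V), hW u.1.2⟩, by
        have hu : Θ.domRestrict W' u.1 = 0 := u.2
        rw [LinearMap.domRestrict_apply] at hu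
        show Θ.domRestrict W ⟨(u.1 : V), hW u.1.2⟩ = 0
        rw [LinearMap.domRestrict_apply]
        exact hu⟩
      map_add' := fun u v => rfl
      map_smul' := fun c u => rfl }
  have hι : Function.Injective ι := by
    intro u v huv
    have h := congrArg (fun w : LinearMap.ker (Θ.domRestrict W) => ((w.1 : W) : V)) huv
    exact Subtype.ext (Subtype.ext h)
  have hker := LinearMap.finrank_le_finrank_of_injective hι
  omega

/-! ## The separator rank law -/

/-- **Separator rank law.**  For a bi-invariant `J`, a `J`-separated triple `(X, Y, Z)` and ANY separator
`f ∈ J` of a target `(x₀, z₀)`: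
`|Y|·(|X| + |Z|) + dim span{L_g f : g ∈ G} ≤ 2·dim J + |Y|`, where `(L_g f)(h) = f(g h)`.
In particular a separator generating `J` as a left-translation module forces the Neumann-Y count
`|Y|(|X| + |Z| − 1) ≤ dim J`, and near the graded Neumann wall every separator is degenerate. -/
theorem separator_rank_law {G : Type} [Group G] [Fintype G] (J : Submodule ℂ (G → ℂ))
    (hL : ∀ f ∈ J, ∀ a : G, (fun g : G => f (a * g)) ∈ J)
    (hR : ∀ f ∈ J, ∀ b : G, (fun g : G => f (g * b)) ∈ J)
    (X Y Z : Finset G)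
    (hsep : ∀ x₀ ∈ X, ∀ z₀ ∈ Z, ∃ f ∈ J, ∀ x ∈ X, ∀ y ∈ Y, ∀ y' ∈ Y, ∀ z ∈ Z,
      (x = x₀ ∧ y = y' ∧ z = z₀ → f (x⁻¹ * y * y'⁻¹ * z) = 1) ∧
      (¬ (x = x₀ ∧ y = y' ∧ z = z₀) → f (x⁻¹ * y * y'⁻¹ * z) = 0))
    {x₀ : G} (hx₀ : x₀ ∈ X) {z₀ : G} (hz₀ : z₀ ∈ Z) {f : G → ℂ} (hf : f ∈ J)
    (hpat : ∀ x ∈ X, ∀ y ∈ Y, ∀ y' ∈ Y, ∀ z ∈ Z,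
      (x = x₀ ∧ y = y' ∧ z = z₀ → f (x⁻¹ * y * y'⁻¹ * z) = 1) ∧
      (¬ (x = x₀ ∧ y = y' ∧ z = z₀) → f (x⁻¹ * y * y'⁻¹ * z) = 0)) :
    Y.card * (X.card + Z.card) +
        Module.finrank ℂ (Submodule.span ℂ (Set.range fun g : G => fun h : G => f (g * h))) ≤
      2 * Module.finrank ℂ J + Y.card := by
  classical
  -- separators in `if` form
  have hite : ∀ x₁ ∈ X, ∀ z₁ ∈ Z, ∃ f₁ : J, ∀ x ∈ X, ∀ y ∈ Y, ∀ y' ∈ Y, ∀ z ∈ Z,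
      (f₁ : G → ℂ) (x⁻¹ * y * y'⁻¹ * z) = if (x = x₁ ∧ y = y' ∧ z = z₁) then 1 else 0 := by
    intro x₁ hx₁ z₁ hz₁
    obtain ⟨f₁, hf₁, hspec⟩ := hsep x₁ hx₁ z₁ hz₁
    refine ⟨⟨f₁, hf₁⟩, fun x hx y hy y' hy' z hz => ?_⟩
    obtain ⟨h1, h0⟩ := hspec x hx y hy y' hy' z hz
    split_ifs with hc
    · exact h1 hc
    · exact h0 hc
  have hfite : ∀ x ∈ X, ∀ y ∈ Y, ∀ y' ∈ Y, ∀ z ∈ Z,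
      f (x⁻¹ * y * y'⁻¹ * z) = if (x = x₀ ∧ y = y' ∧ z = z₀) then 1 else 0 := by
    intro x hx y hy y' hy' z hz
    obtain ⟨h1, h0⟩ := hpat x hx y hy y' hy' z hz
    split_ifs with hc
    · exact h1 hc
    · exact h0 hc
  -- the left translates `L_g f` as elements of `J`
  let Lf : G → J := fun g => ⟨fun h => f (g * h), hL f hf g⟩
  have hLf : ∀ g h, (Lf g : G → ℂ) h = f (g * h) := fun g h => rfl
  -- (★) rank core: rows `L_{x⁻¹y} f`, columns evaluations at `y'⁻¹ z`
  let R : Type := ↥(X ×ˢ Y)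
  let v : R → J := fun r => Lf ((r.1.1)⁻¹ * r.1.2)
  let C : Type := ↥(Y ×ˢ Z)
  have memC : ∀ c : C, c.1.1 ∈ Y ∧ c.1.2 ∈ Z := fun c => Finset.mem_product.mp c.2
  have memR : ∀ r : R, r.1.1 ∈ X ∧ r.1.2 ∈ Y := fun r => Finset.mem_product.mp r.2
  let Ψ : J →ₗ[ℂ] (C → ℂ) := LinearMap.pi fun c : C =>
    (LinearMap.proj (c.1.1⁻¹ * c.1.2) : (G → ℂ) →ₗ[ℂ] ℂ).comp J.subtype
  have hΨ : ∀ (φ : J) (c : C), Ψ φ c = (φ : G → ℂ) (c.1.1⁻¹ * c.1.2) := fun φ c => rfl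
  have hsingle : ∀ c' : C, ∃ φ : J, Ψ φ = fun c => if c = c' then 1 else 0 := by
    intro c'
    obtain ⟨hy'', hz'⟩ := memC c'
    obtain ⟨f', hf'⟩ := hite x₀ hx₀ _ hz'
    refine ⟨⟨fun h => (f' : G → ℂ) (x₀⁻¹ * c'.1.1 * h), hL _ f'.2 _⟩, ?_⟩
    funext c
    obtain ⟨hy', hz⟩ := memC c
    rw [hΨ]
    have harg : x₀⁻¹ * c'.1.1 * (c.1.1⁻¹ * c.1.2) = x₀⁻¹ * c'.1.1 * c.1.1⁻¹ * c.1.2 := by group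
    simp only [harg]
    rw [hf' x₀ hx₀ _ hy'' _ hy' _ hz]
    by_cases hcc : c = c'
    · subst hcc; simp
    · rw [if_neg hcc, if_neg]
      rintro ⟨-, hy, hz2⟩
      apply hcc
      obtain ⟨⟨y', z⟩, hc⟩ := c
      obtain ⟨⟨y'', z'⟩, hc'⟩ := c'
      simp only at hy hz2
      subst hy; subst hz2
      rfl
  have hsurj : Function.Surjective Ψ := by
    intro w
    choose φ hφ using hsingle
    refine ⟨∑ c, w c • φ c, ?_⟩
    rw [map_sum]
    funext c₀
    simp only [map_smul, Finset.sum_apply, Pi.smul_apply, hφ, smul_eq_mul, mul_ite, mul_one,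
      mul_zero]
    rw [Finset.sum_ite_eq]
    simp
  let T : Type := ↥Y
  have memT : ∀ t : T, (x₀, (t : G)) ∈ X ×ˢ Y := fun t => Finset.mem_product.mpr ⟨hx₀, t.2⟩
  let φT : T → (C → ℂ) := fun t => Ψ (v ⟨(x₀, (t : G)), memT t⟩)
  have hφ : ∀ r, Ψ (v r) = 0 ∨ ∃ t, Ψ (v r) = φT t := by
    intro r
    obtain ⟨hxr, hyr⟩ := memR r
    by_cases hrx : r.1.1 = x₀
    · right
      refine ⟨⟨r.1.2, hyr⟩, ?_⟩
      obtain ⟨⟨x, y⟩, hr⟩ := r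
      simp only at hrx
      subst hrx
      rfl
    · left
      funext c
      obtain ⟨hy', hz⟩ := memC c
      rw [hΨ]
      show f (r.1.1⁻¹ * r.1.2 * (c.1.1⁻¹ * c.1.2)) = 0
      have harg : r.1.1⁻¹ * r.1.2 * (c.1.1⁻¹ * c.1.2) = r.1.1⁻¹ * r.1.2 * c.1.1⁻¹ * c.1.2 := by
        group
      rw [harg, hfite _ hxr _ hyr _ hy' _ hz, if_neg]
      rintro ⟨hx, -, -⟩
      exact hrx hx
  have hstar := rank_core_span v Ψ hsurj φT hφ
  have hC : Fintype.card C = Y.card * Z.card := by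
    rw [Fintype.card_coe, Finset.card_product]
  have hT : Fintype.card T = Y.card := Fintype.card_coe _
  rw [hC, hT] at hstar
  -- (★★) `r(f) ≤ dim U + (dim J − |X||Y|)` via `Θ : J* → ℂ^G`, `Θ(λ)(h) = λ(R_h f)`
  let Rf : G → J := fun h => ⟨fun g => f (g * h), hR f hf h⟩
  let Θ : Module.Dual ℂ J →ₗ[ℂ] (G → ℂ) :=
    { toFun := fun lam h => lam (Rf h)
      map_add' := fun _ _ => rfl
      map_smul' := fun _ _ => rfl }
  let evJ : G → Module.Dual ℂ J := fun g => (LinearMap.proj g : (G → ℂ) →ₗ[ℂ] ℂ).comp J.subtype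
  have hΘev : ∀ g, Θ (evJ g) = fun h => f (g * h) := fun g => rfl
  -- `span{L_g f}` is the image of `span{ev_g}`; `U` (as functions) is the image of `span{ev_{x⁻¹y}}`
  set W : Submodule ℂ (Module.Dual ℂ J) := Submodule.span ℂ (Set.range evJ) with hWdef
  set W' : Submodule ℂ (Module.Dual ℂ J) :=
    Submodule.span ℂ (Set.range fun r : R => evJ ((r.1.1)⁻¹ * r.1.2)) with hW'def
  have hW'W : W' ≤ W := by
    rw [hW'def, Submodule.span_le]
    rintro _ ⟨r, rfl⟩
    exact Submodule.subset_span ⟨_, rfl⟩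
  have hmapW : W.map Θ = Submodule.span ℂ (Set.range fun g : G => fun h : G => f (g * h)) := by
    rw [hWdef, Submodule.map_span, ← Set.range_comp]
    rfl
  have hmapW' : W'.map Θ = (Submodule.span ℂ (Set.range v)).map J.subtype := by
    rw [hW'def, Submodule.map_span, Submodule.map_span, ← Set.range_comp, ← Set.range_comp]
    rfl
  have hfinW' : finrank ℂ (W'.map Θ) = finrank ℂ (Submodule.span ℂ (Set.range v)) := by
    rw [hmapW']
    exact Submodule.finrank_map_subtype_eq J _
  have hWle : finrank ℂ W ≤ finrank ℂ J :=
    (Submodule.finrank_le W).trans (Subspace.dual_finrank_eq.le)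
  -- the evaluations at the points `x⁻¹ y` are linearly independent on `J` (the `XY` wall)
  have hlinW' : LinearIndependent ℂ (fun r : R => evJ ((r.1.1)⁻¹ * r.1.2)) := by
    rw [linearIndependent_iff']
    intro s c hrel r₀ hr₀
    obtain ⟨hx₁, hy₁⟩ := memR r₀
    obtain ⟨f₁, hf₁⟩ := hite _ hx₁ z₀ hz₀
    -- test function: `h ↦ f₁ (h · y₁⁻¹ z₀)` (right translate of the separator of `(x₁, z₀)`)
    have key := congrArg (fun lam : Module.Dual ℂ J =>
      lam ⟨fun h => (f₁ : G → ℂ) (h * (r₀.1.2⁻¹ * z₀)), hR _ f₁.2 _⟩) hrel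
    simp only [LinearMap.coe_sum, Finset.sum_apply, LinearMap.smul_apply, LinearMap.zero_apply,
      smul_eq_mul] at key
    have hterm : ∀ r ∈ s, c r * (evJ ((r.1.1)⁻¹ * r.1.2))
        ⟨fun h => (f₁ : G → ℂ) (h * (r₀.1.2⁻¹ * z₀)), hR _ f₁.2 _⟩ =
        if r = r₀ then c r else 0 := by
      intro r _
      obtain ⟨hxr, hyr⟩ := memR r
      show c r * (f₁ : G → ℂ) ((r.1.1)⁻¹ * r.1.2 * (r₀.1.2⁻¹ * z₀)) = _
      have harg : (r.1.1)⁻¹ * r.1.2 * (r₀.1.2⁻¹ * z₀) = (r.1.1)⁻¹ * r.1.2 * r₀.1.2⁻¹ * z₀ := by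
        group
      rw [harg, hf₁ _ hxr _ hyr _ hy₁ z₀ hz₀]
      by_cases hrr : r = r₀
      · subst hrr; simp
      · rw [if_neg hrr, if_neg, mul_zero]
        rintro ⟨hx, hy, -⟩
        apply hrr
        obtain ⟨⟨x, y⟩, hr⟩ := r
        obtain ⟨⟨x₁', y₁'⟩, hr₀'⟩ := r₀
        simp only at hx hy
        subst hx; subst hy
        rfl
    rw [Finset.sum_congr rfl hterm, Finset.sum_ite_eq' s r₀, if_pos hr₀] at key
    exact key
  have hfinW'dual : finrank ℂ W' = X.card * Y.card := by
    rw [hW'def, finrank_span_eq_card hlinW', Fintype.card_coe, Finset.card_product]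
  have hmaple := finrank_map_add_le Θ hW'W
  rw [hmapW, hfinW', hfinW'dual] at hmaple
  have hgoal : Y.card * (X.card + Z.card) = X.card * Y.card + Y.card * Z.card := by ring
  rw [hgoal]
  omega

end Summit.MatrixMultiplication.MatrixMultiplication.Theorems.GradedDesignFamily.Negative

end
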